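import Summits.QuantumFields.BalabanUV.Gaps.CapSignsConstRoad

/-!
# Gaps / CapBlockTransferFloors — the CAP certified at a SMALL block size serves the construction at block size `L^n`, in FLOOR currency:
# a uniform positive floor of the small-block one-loop coefficients TRANSFERS along block sums (the located composition hypothesis
# Q-asym1-5 of `Beta.RateCertificate` §10, or its nearness form §11), and meets the every-slope (0.31) END of `Gaps/CapSignsConstRoad`
# (cell pub-balaban-gaps, seat g1-p3 gen 2, CAP+tail «split ∕ weakening» charge; companion of `CapSignsConstRoad` ∕ `CapTailFloors`)

HONEST FRAMING (cell rule, page 1 of everything): bookkeeping over the β sub-cell's hypothesis carriers; NOTHING of Bałaban's is asserted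
beyond print; [Balaban1987RG1] Thm 2 is UNPROVED IN PRINT and printed for block size «L odd > 11» (p. 251) while one-loop NUMERICS (two-engine,
NON-certified readings) exist only at small block sizes `L ∈ {2, 3, 4}` and the CAP-k custodian's census has ZERO certified β-number rows at ANY L (b2b
cap3, `BETA/CAP-KERNEL.md` §7: «ONE certified INPUT-side row, ZERO certified β-number rows»; cap-ref #116); the COMPOSITION HYPOTHESIS
`hblock : ∀ k, S.β0 k = blockSum n b k` (one-loop coefficients at block size `L^n` = block sums of those at block size `L`) is asym1's located
question Q-asym1-5 — a BINDER, never asserted (three block-size-`L^n` schemes (S1)∕(S2)∕(S3) are distinguished in `Beta.RateCertificate` §10's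
header; `hblock` as an equality speaks to (S1)∕(S2), and to the genuine `L^n`-step (S3) iff Q-asym1-5 (iii) is YES; the honest form for (S3)
is the nearness `NearRate` of §11, used in §2 below); one finite T⁴; 0∕13 main theorems, 0∕9 spine estimates; NOT `BetaPertH`, NOT continuum,
NOT Clay.  HONEST DEPENDENCY (b2b cell, verbatim): «continuum YM on T⁴ ⇐ BetaPertH ∧ nine spine estimates (0/9 proved); BetaPertH ⇐ (D1) ∧
(D4) ∧ CAP+tail; G-an2-4 gates asym, D1 and NE2/3/4.»

WHAT IS HERE ([folklore] sequence algebra + calls BY NAME of the companion file's floor ENDs; the tree's block-transfer ENDs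
`RemainderConstCertified.thm2Printed_of_blockMarginConst` ∕ `…blockNearMarginConst` are the MARGIN × FIXED-`r` road — here the FLOOR ×
every-slope road, where the CAP is the sign list ∕ a uniform floor and `r` is chosen after it):
  * §1 `blockSum_ge_of_floor`: a floor `f ≤ b_j` (all j) gives `n·f ≤ blockSum n b k` (all k); `blockSum_ge_of_eventualFloor` (eventual form);
    `blockSum_pos_of_pos`: signs transfer (`0 < n`).
  * §2 `beta0Floor_of_block` (equality form `hblock`) and `beta0Floor_of_blockNear` (nearness `NearRate (blockSum n b) S.β0 e ϑ`, `0 ≤ ϑ ≤ 1`: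
    floor `n·f − e`): the LARGE-block one-loop coefficients inherit a uniform positive floor from the small-block ones.
  * §3 ENDs at the large block size on the every-slope road: `thm2Printed_of_blockFloor_everySlope` (small-block floor + `hblock` +
    `EverySlope S γc` + (C), (U) ⟹ `B12.Thm2Printed C L'`), `thm2Printed_of_blockNearFloor_everySlope` (nearness, `e < n·f`),
    `betaAFH_of_blockFloor_everySlope`; and the small-block floor from the three lanes AT THE SMALL BLOCK SIZE
    (`CapSignsConstRoad.exists_beta0Floor_of_signs`: rate + ONE certified value + gap + index test + SIGNS, all at block size `L`):
    `thm2Printed_of_blockSigns_everySlope`; and the CAP-free END `endpointExistence_of_blockEventualFloor_everySlope` (eventual small-block floor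
    + `hblock` + `EverySlope` ⟹ `EndpointExistence` at `L'`; nearness form `endpointExistence_of_blockNearEventualFloor_everySlope`).
    Reading for row CAP-k: on this road the computational leaves are SIGNS (and one value) of the
    SMALL-block coefficients — e.g. `L = 3`, `n = 3`, `L' = 27` (print-admissible) — at the price of Q-asym1-5 (`hblock` ∕ `NearRate`) and of
    (D4) in the every-slope currency for the `L'`-construction.  Nothing here lowers either price.
0 sorry; imports the companion file only (which imports `Beta.RemainderConstCertified` ⊇ `Beta.RateCertificate` §10–§11).

CITATION HEADER (tags CONTEXT ONLY).  [I] = T. Bałaban, Commun. Math. Phys. **109** (1987) [Balaban1987RG1]: Thm 2 p. 259 with (0.31); p. 251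
(«L odd > 11»); p. 254 («we may use many other definitions» — a remark, not a theorem); (1.22) p. 264; (2.12)–(2.14) p. 268.
-/

namespace Summit.QuantumFields.BalabanUV.Gaps.CapBlockTransferFloors

open Literature.MathematicalPhysics.QuantumFieldTheory.Balaban1983to89
open Literature.MathematicalPhysics.QuantumFieldTheory.Balaban1983to89.FlowStep
open Literature.MathematicalPhysics.QuantumFieldTheory.Balaban1983to89.FlowStepRuns
open Literature.MathematicalPhysics.QuantumFieldTheory.Balaban1983to89.DagBinding
open Literature.MathematicalPhysics.QuantumFieldTheory.Balaban1983to89.Beta.RateCertificate (GeomRate NearRate blockSum)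
open Literature.MathematicalPhysics.QuantumFieldTheory.Balaban1983to89.Beta.RemainderConstCertified (eventualFormOfFloorConst)
open Summit.QuantumFields.BalabanUV.Gaps.CapSignsConstRoad
open Finset

noncomputable section

variable {β : HBeta}

/-! ## §1 Floors and signs transfer along block sums -/

/-- A uniform floor `f ≤ b_j` gives `n·f ≤ blockSum n b k = Σ_{i<n} b_{nk+i}`. [folklore] -/
theorem blockSum_ge_of_floor {b : ℕ → ℝ} {f : ℝ} (hF : ∀ j, f ≤ b j) (n k : ℕ) : (n : ℝ) * f ≤ blockSum n b k := by
  unfold blockSum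
  calc (n : ℝ) * f = ∑ _i ∈ range n, f := by simp
    _ ≤ ∑ i ∈ range n, b (n * k + i) := sum_le_sum fun i _ => hF _

/-- Signs transfer: `0 < b_j` for all j and `0 < n` give `0 < blockSum n b k`. [folklore] -/
theorem blockSum_pos_of_pos {b : ℕ → ℝ} (hpos : ∀ j, 0 < b j) {n : ℕ} (hn : 0 < n) (k : ℕ) : 0 < blockSum n b k := by
  unfold blockSum
  exact sum_pos (fun i _ => hpos _) ⟨0, mem_range.mpr hn⟩

/-- An EVENTUAL floor transfers too: `f ≤ b_j` for `j ≥ j₀` and `0 < n` give `n·f ≤ blockSum n b k` for `k ≥ j₀` (each index `n·k + i ≥ k ≥ j₀`).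
[folklore] -/
theorem blockSum_ge_of_eventualFloor {b : ℕ → ℝ} {f : ℝ} {j₀ n : ℕ} (hn : 0 < n) (hF : ∀ j, j₀ ≤ j → f ≤ b j) :
    ∀ k, j₀ ≤ k → (n : ℝ) * f ≤ blockSum n b k := fun k hk => by
  unfold blockSum
  calc (n : ℝ) * f = ∑ _i ∈ range n, f := by simp
    _ ≤ ∑ i ∈ range n, b (n * k + i) := sum_le_sum fun i _ => hF _ (hk.trans ((Nat.le_mul_of_pos_left k hn).trans (Nat.le_add_right _ _)))

/-! ## §2 The large-block one-loop coefficients inherit the floor -/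

/-- **Equality form (Q-asym1-5 as `hblock`)**: `S.β0 k = blockSum n b k` and a small-block floor `0 < f ≤ b_j` give the large-block floor
`n·f ≤ β⁰_{k+1}`. [cite: Balaban1987RG1, (1.22) p.264] -/
theorem beta0Floor_of_block (S : B12Beta.OneLoopSplit β) {b : ℕ → ℝ} {n : ℕ} (hblock : ∀ k, S.β0 k = blockSum n b k) {f : ℝ}
    (hF : ∀ j, f ≤ b j) : ∀ k, (n : ℝ) * f ≤ S.β0 k := fun k => (hblock k).symm ▸ blockSum_ge_of_floor hF n k

/-- **Nearness form (Q-asym1-5 (iii) in inequality currency, `Beta.RateCertificate.NearRate`)**: `|β⁰_{k+1} − blockSum n b k| ≤ e·ϑ^k` with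
`0 ≤ ϑ ≤ 1` and a small-block floor `f ≤ b_j` give the large-block floor `n·f − e ≤ β⁰_{k+1}`. [cite: Balaban1987RG1, (1.22) p.264] -/
theorem beta0Floor_of_blockNear (S : B12Beta.OneLoopSplit β) {b : ℕ → ℝ} {n : ℕ} {e ϑ : ℝ}
    (hnear : NearRate (blockSum n b) S.β0 e ϑ) (hϑ0 : 0 ≤ ϑ) (hϑ1 : ϑ ≤ 1) {f : ℝ} (hF : ∀ j, f ≤ b j) :
    ∀ k, (n : ℝ) * f - e ≤ S.β0 k := fun k => by
  have h1 := hnear.sub_le hϑ0 hϑ1 k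
  have h2 := blockSum_ge_of_floor hF n k
  linarith

/-- Eventual form under `hblock`: an eventual small-block floor from `j₀` gives the eventual large-block floor `n·f ≤ β⁰_{k+1}` from `k ≥ j₀`.
[cite: Balaban1987RG1, (1.22) p.264] -/
theorem beta0EventualFloor_of_block (S : B12Beta.OneLoopSplit β) {b : ℕ → ℝ} {n : ℕ} (hn : 0 < n)
    (hblock : ∀ k, S.β0 k = blockSum n b k) {f : ℝ} {j₀ : ℕ} (hF : ∀ j, j₀ ≤ j → f ≤ b j) :
    ∀ k, j₀ ≤ k → (n : ℝ) * f ≤ S.β0 k := fun k hk => (hblock k).symm ▸ blockSum_ge_of_eventualFloor hn hF k hk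

/-! ## §3 ENDs at the large block size on the every-slope road -/

/-- **THEOREM 2 AS PRINTED AT THE LARGE BLOCK SIZE `L'` FROM A SMALL-BLOCK FLOOR, every-slope road**: the DAG at `L'` (`1 < L'`), its split
`S`; a uniform positive floor `0 < f ≤ b_j` of the SMALL-block one-loop coefficients; the composition hypothesis `hblock` (Q-asym1-5, a binder)
with `0 < n`; `EverySlope S γc` for the `L'`-construction; (C), (U) ⟹ `B12.Thm2Printed C L'` (floor `n·f`, `CapSignsConstRoad.thm2Printed_of_beta0Floor_everySlope`).
[cite: Balaban1987RG1, Thm 2 p.259 with (0.31) and (1.22) p.264] -/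
theorem thm2Printed_of_blockFloor_everySlope {C : B12.Construction} (hgen : ForwardGenerated C β) {L' : ℝ} (hL : 1 < L')
    (S : B12Beta.OneLoopSplit β) {b : ℕ → ℝ} {n : ℕ} (hn : 0 < n) (hblock : ∀ k, S.β0 k = blockSum n b k) {f γc β' : ℝ}
    (hf : 0 < f) (hF : ∀ j, f ≤ b j) (hrem : EverySlope S γc) (hcont : BetaContH γc β) (hup : BetaUpperH β' γc β) :
    B12.Thm2Printed C L' :=
  thm2Printed_of_beta0Floor_everySlope hgen hL S (mul_pos (by exact_mod_cast hn) hf) (beta0Floor_of_block S hblock hF) hrem hcont hup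

/-- `BetaAFH β` at the large block size from a small-block floor + `hblock` + `EverySlope`. [folklore] -/
theorem betaAFH_of_blockFloor_everySlope (S : B12Beta.OneLoopSplit β) {b : ℕ → ℝ} {n : ℕ} (hn : 0 < n)
    (hblock : ∀ k, S.β0 k = blockSum n b k) {f γc : ℝ} (hf : 0 < f) (hF : ∀ j, f ≤ b j) (hrem : EverySlope S γc) : BetaAFH β :=
  betaAFH_of_beta0Floor_everySlope S (mul_pos (by exact_mod_cast hn) hf) (beta0Floor_of_block S hblock hF) hrem

/-- **The NEARNESS form** (the honest currency for the genuine `L^n`-step, scheme (S3) of `Beta.RateCertificate` §10): `NearRate (blockSum n b) S.β0 e ϑ`,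
`0 ≤ ϑ ≤ 1`, a small-block floor `f ≤ b_j` with `e < n·f`, `EverySlope S γc`, (C), (U) ⟹ `B12.Thm2Printed C L'` (floor `n·f − e`).
[cite: Balaban1987RG1, Thm 2 p.259 with (0.31) and (1.22) p.264] -/
theorem thm2Printed_of_blockNearFloor_everySlope {C : B12.Construction} (hgen : ForwardGenerated C β) {L' : ℝ} (hL : 1 < L')
    (S : B12Beta.OneLoopSplit β) {b : ℕ → ℝ} {n : ℕ} {e ϑ : ℝ} (hnear : NearRate (blockSum n b) S.β0 e ϑ) (hϑ0 : 0 ≤ ϑ)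
    (hϑ1 : ϑ ≤ 1) {f γc β' : ℝ} (hF : ∀ j, f ≤ b j) (he : e < (n : ℝ) * f) (hrem : EverySlope S γc) (hcont : BetaContH γc β)
    (hup : BetaUpperH β' γc β) : B12.Thm2Printed C L' :=
  thm2Printed_of_beta0Floor_everySlope hgen hL S (sub_pos.mpr he) (beta0Floor_of_blockNear S hnear hϑ0 hϑ1 hF) hrem hcont hup

/-- **THE SIGN ROAD AT THE SMALL BLOCK SIZE, END AT THE LARGE ONE**: the three lanes AT BLOCK SIZE `L` — rate `GeomRate b binf c₀ θ` (`0 ≤ θ ≤ 1`),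
ONE certified value `m ≤ b_{k₁}` with gap `c₀θ^{k₁} < m` and index test at `k₂`, and the SIGN list `0 < b_k` (`k < k₂`) — give the small-block
floor (`CapSignsConstRoad.exists_beta0Floor_of_signs`); with `hblock` (`0 < n`), `EverySlope S γc` for the `L' = L^n` construction, (C), (U):
`B12.Thm2Printed C L'`.  Reading for row CAP-k: certified SIGNS at a small block size (e.g. `L = 3`) serve the printed regime (`L' = 27`) at the
price of Q-asym1-5 and of (D4) in the every-slope currency at `L'`. [cite: Balaban1987RG1, Thm 2 p.259 with (0.31), p.251 and (1.22) p.264] -/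
theorem thm2Printed_of_blockSigns_everySlope {C : B12.Construction} (hgen : ForwardGenerated C β) {L' : ℝ} (hL : 1 < L')
    (S : B12Beta.OneLoopSplit β) {b : ℕ → ℝ} {n : ℕ} (hn : 0 < n) (hblock : ∀ k, S.β0 k = blockSum n b k)
    {binf c₀ θ m γc β' : ℝ} {k₁ k₂ : ℕ} (hθ0 : 0 ≤ θ) (hθ1 : θ ≤ 1) (hconv : GeomRate b binf c₀ θ) (hcert : m ≤ b k₁)
    (hgap : c₀ * θ ^ k₁ < m) (hk₂ : c₀ * θ ^ k₂ ≤ (m - c₀ * θ ^ k₁) / 4) (hsign : ∀ k, k < k₂ → 0 < b k)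
    (hrem : EverySlope S γc) (hcont : BetaContH γc β) (hup : BetaUpperH β' γc β) : B12.Thm2Printed C L' := by
  obtain ⟨f, hf, hF⟩ := exists_beta0Floor_of_signs b hθ0 hθ1 hconv hcert hgap hk₂ hsign
  exact thm2Printed_of_blockFloor_everySlope hgen hL S hn hblock hf hF hrem hcont hup

/-- **THE END STATEMENT AT THE LARGE BLOCK SIZE FROM AN EVENTUAL SMALL-BLOCK FLOOR — NO CAP** (rung L1.2's currency): forward generation, an
EVENTUAL floor `0 < f ≤ b_j` (`j ≥ j₀`) of the small-block one-loop coefficients, `hblock` with `0 < n`, `EverySlope S γc`, (U)∕(L)∕(C) ⟹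
`EndpointExistence C` (asym2's `RemainderConstCertified.eventualFormOfFloorConst` with floor `n·f` from `j₀` and `r := n·f/2`).
[cite: Balaban1987RG1, Thm 2 p.259 (first sentence) and (1.22) p.264] -/
theorem endpointExistence_of_blockEventualFloor_everySlope {C : B12.Construction} (hgen : ForwardGenerated C β)
    (S : B12Beta.OneLoopSplit β) {b : ℕ → ℝ} {n : ℕ} (hn : 0 < n) (hblock : ∀ k, S.β0 k = blockSum n b k) {f γc β' : ℝ} {j₀ : ℕ}
    (hf : 0 < f) (hF : ∀ j, j₀ ≤ j → f ≤ b j) (hrem : EverySlope S γc) (hup : BetaUpperH β' γc β)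
    (hlo : ∀ k, ∀ v ∈ Box γc k, -β' ≤ β k v) (hcont : BetaContH γc β) : EndpointExistence C := by
  have hnf : 0 < (n : ℝ) * f := mul_pos (by exact_mod_cast hn) hf
  obtain ⟨γ, hγ, hγle, hR⟩ := hrem _ (half_pos hnf)
  exact (eventualFormOfFloorConst S hγ (beta0EventualFloor_of_block S hn hblock hF) hR (half_lt_self hnf)
    (fun k v hv => hup k v (box_mono hγle k hv)) (fun k v hv => hlo k v (box_mono hγle k hv))
    (fun k => (hcont k).mono (box_mono hγle k))).endpointExistence hgen

/-- **The same END in the NEARNESS currency** (scheme (S3)): `NearRate (blockSum n b) S.β0 e ϑ` (`0 ≤ ϑ ≤ 1`), an eventual small-block floor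
`f ≤ b_j` (`j ≥ j₀`) with `e < n·f`, `EverySlope S γc`, (U)∕(L)∕(C) ⟹ `EndpointExistence C` (eventual large-block floor `n·f − e` from `j₀`).
[cite: Balaban1987RG1, Thm 2 p.259 (first sentence) and (1.22) p.264] -/
theorem endpointExistence_of_blockNearEventualFloor_everySlope {C : B12.Construction} (hgen : ForwardGenerated C β)
    (S : B12Beta.OneLoopSplit β) {b : ℕ → ℝ} {n : ℕ} (hn : 0 < n) {e ϑ : ℝ} (hnear : NearRate (blockSum n b) S.β0 e ϑ)
    (hϑ0 : 0 ≤ ϑ) (hϑ1 : ϑ ≤ 1) {f γc β' : ℝ} {j₀ : ℕ} (hF : ∀ j, j₀ ≤ j → f ≤ b j) (he : e < (n : ℝ) * f)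
    (hrem : EverySlope S γc) (hup : BetaUpperH β' γc β) (hlo : ∀ k, ∀ v ∈ Box γc k, -β' ≤ β k v)
    (hcont : BetaContH γc β) : EndpointExistence C := by
  have hfl : ∀ k, j₀ ≤ k → (n : ℝ) * f - e ≤ S.β0 k := fun k hk => by
    have h1 := hnear.sub_le hϑ0 hϑ1 k
    have h2 := blockSum_ge_of_eventualFloor hn hF k hk
    linarith
  obtain ⟨γ, hγ, hγle, hR⟩ := hrem _ (half_pos (sub_pos.mpr he))
  exact (eventualFormOfFloorConst S hγ hfl hR (half_lt_self (sub_pos.mpr he))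
    (fun k v hv => hup k v (box_mono hγle k hv)) (fun k v hv => hlo k v (box_mono hγle k hv))
    (fun k => (hcont k).mono (box_mono hγle k))).endpointExistence hgen

end

end Summit.QuantumFields.BalabanUV.Gaps.CapBlockTransferFloors
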